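import Literature.Algebra.Lie.OrthogonalSelfAdjointIrreducibleTypeD
import HarnessLib

/-!
# The traceless self-adjoint matrices `𝔤_+` of a split ODD orthogonal form are an IRREDUCIBLE `𝔬(2l+1)`-module — in matrices and basis-free (Looijenga–Lunts 1997, Appendix (7.5): "The summands are irreducible", the summand `𝔤_+(U)`, type `B_ℓ`)

Topic `Literature/Algebra/Lie` (namespace `Literature.Algebra.Lie.OrthogonalSelfAdjointTypeB`).  Lane `lit-hodgefound`
(Track 2 foundations library), Layer A1, skeleton seat `lit-hodgefound-skel-1` (generation 50), row **A1-178** of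
`run/shared/lean/pub/lit-hodgefound/SKELETON.md` — the odd-dimensional companion of rows A1-174/175
(`OrthogonalSelfAdjointIrreducibleTypeD.lean`, imported: its extraction lemmas, its core and its transport core are
REUSED on the `𝔬(2l)`-block), following the pattern "type `D` first, then the first row and column" of row A1-170
(`OrthogonalSimpleTypeB.lean`, whose block form, short root vectors `u_i = E_{0,i'} - 2E_{i,0}` and embedded units are
reused).  THEOREMS ONLY about Mathlib objects (`LieAlgebra.Orthogonal.typeB l K = 𝔬(2l+1, K)` for
`JB l K = (2) ⊕ (0 I; I 0)`, `Matrix.IsSelfAdjoint`, `selfAdjointMatricesSubmodule`, `Matrix.trace`,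
`LinearMap.BilinForm.selfAdjointSubmodule`, `LinearMap.trace`); no definition, no named fact, no `sorry` (net debt `0`);
no instance, no notation.

## Source, VERBATIM (held TeX `paper:arxiv-alg-geom_9604014`, p0028 L80–L94)

> "Let `U` be vector space of finite dimension `≥ 2` with a nondegenerate `ε`-symmetric form and denote its Lie algebra
> of infinitesimal automorphisms by `𝔞𝔲𝔱(U)`. Let `𝔤_±(U)` be the set of `x ∈ 𝔰𝔩(U)` satisfying `⟨xu, u'⟩ = ±⟨u, xu'⟩`
> and let `𝔤_0(U)` denote the scalar operators in `𝔤𝔩(U)`.  (7.5) Lemma. Suppose that `U` is not an inner product space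
> of dimension two. Then `𝔤𝔩_-(U) = 𝔞𝔲𝔱(U)` and `𝔤𝔩(U) = 𝔤_-(U) ⊕ 𝔤_0(U) ⊕ 𝔤_+(U)` is an `𝔞𝔲𝔱(U)`-invariant
> decomposition. The summands are irreducible, except when `U` is an inner product space of dimension `4`. […]
> Proof. The first statements are well-known."

Here `ε = 1`, `dim U = 2l + 1` ODD, split form `s = JB l K` (a vector of square `2` orthogonal to `l` hyperbolic pairs —
Mathlib's form of `B_ℓ`, [Humphreys1972, §1.2 p. 3] up to the corner entry `2`); `𝔞𝔲𝔱(U) = 𝔬(2l+1) = typeB l K`;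
`𝔤_+(U) = {X : Xᵀs = sX, tr X = 0}` — the `(x r; c Y)` with `c = 2s'rᵀ`, `Y` `s'`-self-adjoint (`s' = JD`) and
`x + tr Y = 0` (`fromBlocks_isSelfAdjoint_JB_iff'`), i.e. `Sym²₀` of the defining representation of `B_ℓ`.

## Proof

Step 1 (`exists_emb_single_mem_of_ne_zero`).  Project a stable `P` onto the `𝔬(2l)`-block: the image is an
`ad 𝔬(2l)`-stable space of `JD`-self-adjoint matrices (`[(0 0; 0 A), (x r; c Y)] = (0 -rA; Ac [A, Y])`, `emb_comm`), so
rows A1-174's extraction lemmas (`…_of_lowerLeft/upperRight/upperLeft`, which need no trace condition) produce a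
member `W ∈ P` whose block is `E_{uu'}` as soon as some member has a usable block entry; a member with a non-zero FIRST-ROW
entry acquires one after the bracket with `u_i` (`([u_i, X])_{i,q} = -2X_{0,q}`), and a member with neither is `c·1`
with `tr = (2l+1)c` — here `2l + 1 ≠ 0` in `K` enters.  The sandwich with the embedded `p_{au}` kills the first row and
column (`emb_mul_mul_emb`) and squeezes `W` to `(0 0; 0 -E_{a'a}) ∈ P`.
Step 2.  The embedded subspace `{Z | (0 0; 0 Z) ∈ P}` is `ad 𝔬(2l)`-stable, traceless, `JD`-self-adjoint and now
non-zero, so rows A1-174's core puts every embedded traceless `JD`-self-adjoint matrix into `P` (`l ≠ 0` in `K`,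
`|l| ≥ 2`).  Step 3 (`mem_of_forall_emb_mem`).  The brackets `[u_i, (0 0; 0 E_{i'j} + E_{j'i})] = E_{0,j} + 2E_{j',0}`,
`[u_i, (0 0; 0 E_{ji} + E_{i'j'})] = E_{0,j'} + 2E_{j,0}` (`i ≠ j`) and `[u_i, E_{0,i} + 2E_{i',0}] = 2(2E_{00} - E_{ii} - E_{i'i'})`
give the first row/column and the last diagonal direction; `(x r; c Y) = Σ_q r_q(E_{0,q} + 2E_{q̄,0}) +
½x·(2E_{00} - d_i) + (0 0; 0 Y + ½x d_i)` (`d_i = E_{ii} + E_{i'i'}`, the last block traceless) finishes.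

## Contents (all proved)

* §1 `isSelfAdjoint_JB_iff`, `fromBlocks_isSelfAdjoint_JB_iff`, **`fromBlocks_isSelfAdjoint_JB_iff'`** (`c = 2s'rᵀ ∧ Y`
  `s'`-self-adjoint; any commutative ring), `toBlocks₂₂_isSelfAdjoint`, `toBlocks₂₁_eq`, entries `apply_inr_inl_inl`
  (`X_{a,0} = 2X_{0,a'}`), `apply_inr_inr_inl`, `apply_inr_inr_inr_inr`, `trace_eq` (`tr X = X_{00} + 2Σ_a X_{aa}`);
* §2 `emb_mul_mul_emb`, `emb_comm`, `emb_mul_emb`, `usub_comm_apply_inr_inl_inr` (`([u_i, X])_{i,q} = -2X_{0,q}`),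
  `usub_comm_apply_inl_inr_inr` (`([u_i, X])_{0,i'} = X_{i'i'} - X_{00}`), `usub_comm_emb_cadd`, `usub_comm_emb_qadd`,
  `usub_comm_wadd`;
* §3 **`exists_emb_single_mem_of_ne_zero`** (Step 1); §4 **`mem_of_forall_emb_mem`** (Step 3),
  **`eq_bot_or_forall_mem_of_forall_comm_mem`** (the core: `2 ≠ 0`, `|l| ≠ 0`, `2|l|+1 ≠ 0` in `K`, `|l| ≥ 2`);
* §5 `mem_selfAdjoint_inf_ker_trace_iff`, **`eq_bot_or_eq_of_forall_comm_mem`** (`P = ⊥ ∨ P = sym_s ⊓ ker tr`), `…_of_charZero`;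
* §6 (basis-free) **`eq_bot_or_eq_of_forall_lie_mem_of_toMatrix_eq_JB`** (a basis with Gram `JB m K`),
  **`eq_bot_or_eq_of_forall_lie_mem_of_odd`** (algebraically closed `K`, `B` non-degenerate symmetric,
  `dim U = 2m + 1 ≥ 5`; row A1-171's `exists_basis_toMatrix_eq_JB`), `…_of_odd_of_charZero`.

## Scope

Odd dimension `2l + 1 ≥ 5` (`|l| ≥ 2`).  NOT covered here: `dim U = 3` (`B_1`: `Sym²₀K³` is the `5`-dimensional
`𝔰𝔩₂`-module — the `D_1`-block used here is the reducible hyperbolic plane, so the present route does not reach it; it is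
proved directly in the sibling file `OrthogonalSelfAdjointIrreducibleTypeBOne.lean`, row A1-179, for `2, 3 ≠ 0`), real
non-split forms, and the identification with `Sym²₀` as abstract modules.  The
characteristic hypotheses (`2`, `l`, `2l+1` non-zero in `K`) are not in the source (`K = ℂ`) and are those of the method
(`2l + 1 ≠ 0` is necessary: otherwise the identity of `U` is traceless and spans a stable line).  With rows A1-171/172
(`𝔤_-`), A1-174/175 (`𝔤_+`, even), A1-166/176 (symplectic) and A1-179 (`dim U = 3`) this completes "the summands are
irreducible" for all `U` of dimension `≥ 3` over `ℂ`.  Nothing here is a case of the Hodge conjecture.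

## References

* [LooijengaLunts1997] E. Looijenga, V. A. Lunts, *A Lie algebra attached to a projective variety*, Invent. Math. 129
  (1997) 361–412, Appendix Lemma (7.5), p. 28.
* [Humphreys1972] J. E. Humphreys, *Introduction to Lie Algebras and Representation Theory*, GTM 9, Springer 1972,
  §1.2 p. 3 (type B_ℓ), §2 Exercise 6, §19.2, §20.1–§20.2.
-/

namespace Literature.Algebra.Lie.OrthogonalSelfAdjointTypeB

open LieAlgebra LieAlgebra.Orthogonal Matrix Sum

variable {l : Type*} [Fintype l] [DecidableEq l] {R : Type*} [CommRing R] {K : Type*} [Field K]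

/-! ### Matrix units (file-private plumbing) -/

/-- Matrix units: `E_{pq}E_{rs} = 0` for `q ≠ r`. [folklore] -/
private theorem E_mul_E_of_ne {ι : Type*} [Fintype ι] [DecidableEq ι] {p q r s : ι} (h : q ≠ r) :
    single p q (1 : R) * single r s (1 : R) = 0 :=
  single_mul_single_of_ne _ _ _ _ h _

/-- Matrix units: `E_{pq}E_{qs} = E_{ps}`. [folklore] -/
private theorem E_mul_E {ι : Type*} [Fintype ι] [DecidableEq ι] (p q s : ι) :
    single p q (1 : R) * single q s (1 : R) = single p s 1 := by
  rw [single_mul_single_same, mul_one]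

/-- `E_{p,0}E_{q',s} = 0` (sizes `2l+1`). [folklore] -/
private theorem E_inl_mul_E_inr (p s : Unit ⊕ (l ⊕ l)) (x : Unit) (q : l ⊕ l) :
    single p (inl x) (1 : R) * single (inr q) s (1 : R) = 0 :=
  E_mul_E_of_ne inl_ne_inr

/-- `E_{p,q'}E_{0,s} = 0` (sizes `2l+1`). [folklore] -/
private theorem E_inr_mul_E_inl (p s : Unit ⊕ (l ⊕ l)) (q : l ⊕ l) (x : Unit) :
    single p (inr q) (1 : R) * single (inl x) s (1 : R) = 0 :=
  E_mul_E_of_ne inr_ne_inl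

/-- `E_{p,a}E_{b',s} = 0` inside the `𝔬(2l)` block. [folklore] -/
private theorem E_inrinl_mul_E_inrinr (p s : Unit ⊕ (l ⊕ l)) (a b : l) :
    single p (inr (inl a)) (1 : R) * single (inr (inr b)) s (1 : R) = 0 :=
  E_mul_E_of_ne fun h => inl_ne_inr (inr_injective h)

/-- `E_{p,a'}E_{b,s} = 0` inside the `𝔬(2l)` block. [folklore] -/
private theorem E_inrinr_mul_E_inrinl (p s : Unit ⊕ (l ⊕ l)) (a b : l) :
    single p (inr (inr a)) (1 : R) * single (inr (inl b)) s (1 : R) = 0 :=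
  E_mul_E_of_ne fun h => inr_ne_inl (inr_injective h)

omit [DecidableEq l] in
/-- `tr (x r; c Y) = x₀₀ + tr Y` over `Unit ⊕ (l ⊕ l)`. [folklore] -/
private theorem trace_fromBlocks' (x : Matrix Unit Unit R) (r : Matrix Unit (l ⊕ l) R) (c : Matrix (l ⊕ l) Unit R)
    (Y : Matrix (l ⊕ l) (l ⊕ l) R) : Matrix.trace (fromBlocks x r c Y) = x () () + Matrix.trace Y := by
  rw [Matrix.trace, Matrix.trace, Fintype.sum_sum_type, Fintype.sum_unique]
  simp only [diag_apply, fromBlocks_apply₁₁, fromBlocks_apply₂₂, PUnit.default_eq_unit]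

/-! ### §1 Self-adjoint matrices for `s = JB l R = (2) ⊕ (0 I; I 0)`: block form, entries, trace -/

/-- `X` is self-adjoint for `s = JB` iff `Xᵀs = sX` (definitional). [cite: LooijengaLunts1997, Appendix (7.5), p. 28 L80–L84] -/
theorem isSelfAdjoint_JB_iff (X : Matrix (Unit ⊕ (l ⊕ l)) (Unit ⊕ (l ⊕ l)) R) :
    (JB l R).IsSelfAdjoint X ↔ Xᵀ * JB l R = JB l R * X :=
  Iff.rfl

/-- **Block form of the `s`-self-adjoint matrices for `s = JB`** (first row/column separated, `(x r; c Y)`):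
`2xᵀ = 2x ∧ cᵀs' = 2r ∧ 2rᵀ = s'c ∧ Yᵀs' = s'Y` (`s' = JD`; Mathlib's corner entry of `JB` is `2`).
[cite: Humphreys1972, §1.2, p. 3 (type B_ℓ, "partition x in the same form as s")] [cite: LooijengaLunts1997, Appendix (7.5), p. 28] -/
theorem fromBlocks_isSelfAdjoint_JB_iff (x : Matrix Unit Unit R) (r : Matrix Unit (l ⊕ l) R) (c : Matrix (l ⊕ l) Unit R)
    (Y : Matrix (l ⊕ l) (l ⊕ l) R) :
    (JB l R).IsSelfAdjoint (fromBlocks x r c Y) ↔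
      (2 : R) • xᵀ = (2 : R) • x ∧ cᵀ * JD l R = (2 : R) • r ∧ (2 : R) • rᵀ = JD l R * c ∧ (JD l R).IsSelfAdjoint Y := by
  rw [isSelfAdjoint_JB_iff, JB, fromBlocks_transpose, fromBlocks_multiply, fromBlocks_multiply, fromBlocks_inj,
    OrthogonalSelfAdjointTypeD.isSelfAdjoint_JD_iff]
  simp only [Matrix.mul_zero, Matrix.zero_mul, zero_add, add_zero, Matrix.mul_smul, Matrix.smul_mul, Matrix.mul_one,
    Matrix.one_mul]

/-- Block form, solved (any commutative ring — no division needed): `(x r; c Y)` is `JB`-self-adjoint iff `c = 2 s' rᵀ` and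
`Y` is `s'`-self-adjoint (`x` is free; the conditions `2xᵀ = 2x`, `cᵀs' = 2r` follow).
[cite: Humphreys1972, §1.2, p. 3 (type B_ℓ)] [cite: LooijengaLunts1997, Appendix (7.5), p. 28] -/
theorem fromBlocks_isSelfAdjoint_JB_iff' (x : Matrix Unit Unit R)
    (r : Matrix Unit (l ⊕ l) R) (c : Matrix (l ⊕ l) Unit R) (Y : Matrix (l ⊕ l) (l ⊕ l) R) :
    (JB l R).IsSelfAdjoint (fromBlocks x r c Y) ↔ c = (2 : R) • (JD l R * rᵀ) ∧ (JD l R).IsSelfAdjoint Y := by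
  rw [fromBlocks_isSelfAdjoint_JB_iff]
  constructor
  · rintro ⟨-, -, hr, hY⟩
    refine ⟨?_, hY⟩
    have h := congr_arg (fun m => JD l R * m) hr
    rw [Matrix.mul_smul, ← Matrix.mul_assoc, OrthogonalSimpleTypeD.JD_mul_JD, Matrix.one_mul] at h
    exact h.symm
  · rintro ⟨rfl, hY⟩
    refine ⟨?_, ?_, ?_, hY⟩
    · have hxt : xᵀ = x := by
        ext i j
        rw [transpose_apply, Subsingleton.elim j i]
      rw [hxt]
    · rw [transpose_smul, transpose_mul, transpose_transpose, OrthogonalSimpleTypeD.JD_transpose, Matrix.smul_mul,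
        Matrix.mul_assoc, OrthogonalSimpleTypeD.JD_mul_JD, Matrix.mul_one]
    · rw [Matrix.mul_smul, ← Matrix.mul_assoc, OrthogonalSimpleTypeD.JD_mul_JD, Matrix.one_mul]

section entries

variable {X : Matrix (Unit ⊕ (l ⊕ l)) (Unit ⊕ (l ⊕ l)) R}

/-- The `𝔬(2l)`-block of a `JB`-self-adjoint matrix is `JD`-self-adjoint. [cite: Humphreys1972, §1.2, p. 3] -/
theorem toBlocks₂₂_isSelfAdjoint (hX : (JB l R).IsSelfAdjoint X) :
    (JD l R).IsSelfAdjoint X.toBlocks₂₂ := by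
  rw [← fromBlocks_toBlocks X, fromBlocks_isSelfAdjoint_JB_iff'] at hX
  exact hX.2

/-- First column from first row: `c = 2 s' rᵀ`. [cite: Humphreys1972, §1.2, p. 3] -/
theorem toBlocks₂₁_eq (hX : (JB l R).IsSelfAdjoint X) :
    X.toBlocks₂₁ = (2 : R) • (JD l R * X.toBlocks₁₂ᵀ) := by
  rw [← fromBlocks_toBlocks X, fromBlocks_isSelfAdjoint_JB_iff'] at hX
  exact hX.1

/-- `X_{a,0} = 2X_{0,a'}`. [cite: Humphreys1972, §1.2, p. 3] -/
theorem apply_inr_inl_inl (hX : (JB l R).IsSelfAdjoint X) (a : l) :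
    X (inr (inl a)) (inl ()) = 2 * X (inl ()) (inr (inr a)) := by
  have h := congrFun (congrFun (toBlocks₂₁_eq hX) (inl a)) ()
  rw [Matrix.smul_apply, OrthogonalSimpleTypeB.JD_mul_apply_inl, transpose_apply, smul_eq_mul] at h
  exact h

/-- `X_{a',0} = 2X_{0,a}`. [cite: Humphreys1972, §1.2, p. 3] -/
theorem apply_inr_inr_inl (hX : (JB l R).IsSelfAdjoint X) (a : l) :
    X (inr (inr a)) (inl ()) = 2 * X (inl ()) (inr (inl a)) := by
  have h := congrFun (congrFun (toBlocks₂₁_eq hX) (inr a)) ()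
  rw [Matrix.smul_apply, OrthogonalSimpleTypeB.JD_mul_apply_inr, transpose_apply, smul_eq_mul] at h
  exact h

/-- `X_{a'b'} = X_{ba}` inside the `𝔬(2l)`-block. [cite: Humphreys1972, §1.2, p. 3] -/
theorem apply_inr_inr_inr_inr (hX : (JB l R).IsSelfAdjoint X) (a b : l) :
    X (inr (inr a)) (inr (inr b)) = X (inr (inl b)) (inr (inl a)) :=
  OrthogonalSelfAdjointTypeD.apply_inr_inr (toBlocks₂₂_isSelfAdjoint hX) a b

/-- `tr X = X_{00} + 2 Σ_a X_{aa}`. [cite: LooijengaLunts1997, Appendix (7.5), p. 28 (𝔤_+(U) ⊂ 𝔰𝔩(U))] -/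
theorem trace_eq (hX : (JB l R).IsSelfAdjoint X) :
    Matrix.trace X = X (inl ()) (inl ()) + 2 * ∑ a, X (inr (inl a)) (inr (inl a)) := by
  have h := OrthogonalSelfAdjointTypeD.trace_eq_two_mul_sum (toBlocks₂₂_isSelfAdjoint hX)
  conv_lhs => rw [← fromBlocks_toBlocks X, trace_fromBlocks']
  rw [h]
  rfl

end entries

/-! ### §2 The `𝔬(2l)`-block: embedded sandwiches and brackets; the short root vector `u_i` -/

omit [DecidableEq l] in
/-- `(0 0; 0 S)(x r; c Y)(0 0; 0 S') = (0 0; 0 SYS')`: sandwiching by embedded matrices kills the first row and column.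
[cite: Humphreys1972, §1.2, p. 3 (type B_ℓ block partition)] -/
theorem emb_mul_mul_emb (S S' : Matrix (l ⊕ l) (l ⊕ l) R) (x : Matrix Unit Unit R) (r : Matrix Unit (l ⊕ l) R)
    (c : Matrix (l ⊕ l) Unit R) (Y : Matrix (l ⊕ l) (l ⊕ l) R) :
    fromBlocks (0 : Matrix Unit Unit R) 0 0 S * fromBlocks x r c Y * fromBlocks (0 : Matrix Unit Unit R) 0 0 S'
      = fromBlocks 0 0 0 (S * Y * S') := by
  rw [fromBlocks_multiply, fromBlocks_multiply]
  simp

omit [DecidableEq l] in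
/-- `[(0 0; 0 A), (x r; c Y)] = (0 -rA; Ac AY - YA)`. [cite: Humphreys1972, §1.2, p. 3 (type B_ℓ block partition)] -/
theorem emb_comm (A : Matrix (l ⊕ l) (l ⊕ l) R) (x : Matrix Unit Unit R) (r : Matrix Unit (l ⊕ l) R)
    (c : Matrix (l ⊕ l) Unit R) (Y : Matrix (l ⊕ l) (l ⊕ l) R) :
    fromBlocks (0 : Matrix Unit Unit R) 0 0 A * fromBlocks x r c Y - fromBlocks x r c Y * fromBlocks (0 : Matrix Unit Unit R) 0 0 A
      = fromBlocks 0 (-(r * A)) (A * c) (A * Y - Y * A) := by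
  rw [fromBlocks_multiply, fromBlocks_multiply, sub_eq_add_neg, fromBlocks_neg, fromBlocks_add]
  simp [sub_eq_add_neg]

omit [DecidableEq l] in
/-- `(0 0; 0 A)(0 0; 0 B) = (0 0; 0 AB)`. [folklore] [cite: Humphreys1972, §1.2, p. 3] -/
theorem emb_mul_emb (A B : Matrix (l ⊕ l) (l ⊕ l) R) :
    fromBlocks (0 : Matrix Unit Unit R) 0 0 A * fromBlocks (0 : Matrix Unit Unit R) 0 0 B = fromBlocks 0 0 0 (A * B) := by
  rw [fromBlocks_multiply]
  simp

/-- The `𝔬(2l)`-block of `[u_i, X]`: `([u_i, X])_{a, q} = -2X_{0,q}` at row `a = i` for `q ≠ i'`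
(`u_i = E_{0,i'} - 2E_{i,0}`). [cite: Humphreys1972, §1.2, p. 3 (type B_ℓ: e_{1,ℓ+i+1} - e_{i+1,1})] -/
theorem usub_comm_apply_inr_inl_inr (X : Matrix (Unit ⊕ (l ⊕ l)) (Unit ⊕ (l ⊕ l)) K) {i : l} {q : l ⊕ l}
    (hq : q ≠ inr i) :
    (((single (inl ()) (inr (inr i)) (1 : K) - (2 : K) • single (inr (inl i)) (inl ()) 1) * X
        - X * (single (inl ()) (inr (inr i)) (1 : K) - (2 : K) • single (inr (inl i)) (inl ()) 1)
        : Matrix (Unit ⊕ (l ⊕ l)) (Unit ⊕ (l ⊕ l)) K)) (inr (inl i)) (inr q)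
      = -(2 * X (inl ()) (inr q)) := by
  have hq' : (inr q : Unit ⊕ (l ⊕ l)) ≠ inr (inr i) := fun h => hq (inr_injective h)
  rw [Matrix.sub_apply, Matrix.sub_mul, Matrix.mul_sub, Matrix.sub_apply, Matrix.sub_apply, Matrix.smul_mul,
    Matrix.mul_smul, Matrix.smul_apply, Matrix.smul_apply, single_mul_apply_of_ne (h := inr_ne_inl),
    single_mul_apply_same, mul_single_apply_of_ne (hbj := hq'), mul_single_apply_of_ne (hbj := inr_ne_inl), smul_zero,
    sub_zero, sub_zero, zero_sub, one_mul, smul_eq_mul]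

/-- The first row of `[u_i, X]` at `i'`: `([u_i, X])_{0,i'} = X_{i'i'} - X_{00}`. [cite: Humphreys1972, §1.2, p. 3 (type B_ℓ)] -/
theorem usub_comm_apply_inl_inr_inr (X : Matrix (Unit ⊕ (l ⊕ l)) (Unit ⊕ (l ⊕ l)) K) (i : l) :
    (((single (inl ()) (inr (inr i)) (1 : K) - (2 : K) • single (inr (inl i)) (inl ()) 1) * X
        - X * (single (inl ()) (inr (inr i)) (1 : K) - (2 : K) • single (inr (inl i)) (inl ()) 1)
        : Matrix (Unit ⊕ (l ⊕ l)) (Unit ⊕ (l ⊕ l)) K)) (inl ()) (inr (inr i))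
      = X (inr (inr i)) (inr (inr i)) - X (inl ()) (inl ()) := by
  rw [Matrix.sub_apply, Matrix.sub_mul, Matrix.mul_sub, Matrix.sub_apply, Matrix.sub_apply, Matrix.smul_mul,
    Matrix.mul_smul, Matrix.smul_apply, Matrix.smul_apply, single_mul_apply_same,
    single_mul_apply_of_ne (h := inl_ne_inr), mul_single_apply_same, mul_single_apply_of_ne (hbj := inr_ne_inl),
    smul_zero, sub_zero, sub_zero, one_mul, mul_one]

/-- `[u_i, E_{i'j} + E_{j'i}] = E_{0,j} + 2E_{j',0}` for `i ≠ j` (indices of the `𝔬(2l)` block; `u_i = E_{0,i'} - 2E_{i,0}`).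
[cite: Humphreys1972, §1.2, p. 3 (type B_ℓ)] -/
theorem usub_comm_emb_cadd {i j : l} (hij : i ≠ j) :
    (single (inl ()) (inr (inr i)) (1 : R) - (2 : R) • single (inr (inl i)) (inl ()) 1)
        * (single (inr (inr i)) (inr (inl j)) (1 : R) + single (inr (inr j)) (inr (inl i)) 1)
      - (single (inr (inr i)) (inr (inl j)) (1 : R) + single (inr (inr j)) (inr (inl i)) 1)
        * (single (inl ()) (inr (inr i)) (1 : R) - (2 : R) • single (inr (inl i)) (inl ()) 1)
      = single (inl ()) (inr (inl j)) 1 + (2 : R) • single (inr (inr j)) (inl ()) 1 := by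
  have h1 : (inr (inr i) : Unit ⊕ (l ⊕ l)) ≠ inr (inr j) := fun h => hij (inr_injective (inr_injective h))
  have h2 : (inr (inl j) : Unit ⊕ (l ⊕ l)) ≠ inr (inl i) := fun h => hij (inl_injective (inr_injective h)).symm
  simp only [Matrix.sub_mul, Matrix.mul_sub, Matrix.add_mul, Matrix.mul_add, Matrix.smul_mul, Matrix.mul_smul, E_mul_E,
    E_mul_E_of_ne h1, E_mul_E_of_ne h2, E_inl_mul_E_inr, E_inr_mul_E_inl]
  module

/-- `[u_i, E_{ji} + E_{i'j'}] = E_{0,j'} + 2E_{j,0}` (all `i, j`). [cite: Humphreys1972, §1.2, p. 3 (type B_ℓ)] -/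
theorem usub_comm_emb_qadd (i j : l) :
    (single (inl ()) (inr (inr i)) (1 : R) - (2 : R) • single (inr (inl i)) (inl ()) 1)
        * (single (inr (inl j)) (inr (inl i)) (1 : R) + single (inr (inr i)) (inr (inr j)) 1)
      - (single (inr (inl j)) (inr (inl i)) (1 : R) + single (inr (inr i)) (inr (inr j)) 1)
        * (single (inl ()) (inr (inr i)) (1 : R) - (2 : R) • single (inr (inl i)) (inl ()) 1)
      = single (inl ()) (inr (inr j)) 1 + (2 : R) • single (inr (inl j)) (inl ()) 1 := by
  have h1 : (inr (inr i) : Unit ⊕ (l ⊕ l)) ≠ inr (inl j) := fun h => inr_ne_inl (inr_injective h)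
  simp only [Matrix.sub_mul, Matrix.mul_sub, Matrix.add_mul, Matrix.mul_add, Matrix.smul_mul, Matrix.mul_smul, E_mul_E,
    E_mul_E_of_ne h1, E_inl_mul_E_inr, E_inr_mul_E_inl, E_inrinr_mul_E_inrinl]
  module

/-- `[u_i, E_{0,i} + 2E_{i',0}] = 2(2E_{00} - E_{ii} - E_{i'i'})`. [cite: Humphreys1972, §1.2, p. 3 (type B_ℓ)] -/
theorem usub_comm_wadd (i : l) :
    (single (inl ()) (inr (inr i)) (1 : R) - (2 : R) • single (inr (inl i)) (inl ()) 1)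
        * (single (inl ()) (inr (inl i)) (1 : R) + (2 : R) • single (inr (inr i)) (inl ()) 1)
      - (single (inl ()) (inr (inl i)) (1 : R) + (2 : R) • single (inr (inr i)) (inl ()) 1)
        * (single (inl ()) (inr (inr i)) (1 : R) - (2 : R) • single (inr (inl i)) (inl ()) 1)
      = (2 : R) • ((2 : R) • single (inl ()) (inl ()) 1 - single (inr (inl i)) (inr (inl i)) 1
          - single (inr (inr i)) (inr (inr i)) 1) := by
  simp only [Matrix.sub_mul, Matrix.mul_sub, Matrix.add_mul, Matrix.mul_add, Matrix.smul_mul, Matrix.mul_smul, E_mul_E,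
    E_inl_mul_E_inr, E_inr_mul_E_inl]
  module

/-! ### §3 Extraction: a non-zero traceless `JB`-self-adjoint member of an `ad 𝔬(2l+1)`-stable `P` yields an embedded `E_{a'a}` -/

section stable

variable {P : Submodule K (Matrix (Unit ⊕ (l ⊕ l)) (Unit ⊕ (l ⊕ l)) K)}

/-- **Step 1.** Let `P` be a `K`-subspace of traceless `JB`-self-adjoint matrices stable under `m ↦ Ym - mY`
(`Y ∈ 𝔬(2l+1) = typeB`), `2 ≠ 0`, `2|l| + 1 ≠ 0` in `K`, `|l| ≥ 2`.  A non-zero `X ∈ P` yields an EMBEDDED unit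
`(0 0; 0 E_{a'a}) ∈ P`: project `P` onto the `𝔬(2l)`-block (an `ad 𝔬(2l)`-stable space of `JD`-self-adjoint matrices, to
which rows A1-174's extraction lemmas apply), after moving a first-row entry into the block with `[u_i, ·]` if
necessary (a member with no usable entry is `c·1`, and `tr = (2|l|+1)c`); a member whose block is `E_{uu'}` is then
squeezed to `(0 0; 0 -E_{a'a})` by the sandwich with the embedded `p_{au}`. [cite: Humphreys1972, §2 Exercise 6, §19.2, §20.1] [cite: LooijengaLunts1997, Appendix (7.5), p. 28 L89] -/
theorem exists_emb_single_mem_of_ne_zero (h2 : (2 : K) ≠ 0) (hl' : ((2 * Fintype.card l + 1 : ℕ) : K) ≠ 0)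
    (h1 : 1 < Fintype.card l)
    (hP : ∀ ⦃Y m : Matrix (Unit ⊕ (l ⊕ l)) (Unit ⊕ (l ⊕ l)) K⦄, Y ∈ typeB l K → m ∈ P → Y * m - m * Y ∈ P)
    (hPS : ∀ ⦃m : Matrix (Unit ⊕ (l ⊕ l)) (Unit ⊕ (l ⊕ l)) K⦄, m ∈ P → (JB l K).IsSelfAdjoint m)
    (hPT : ∀ ⦃m : Matrix (Unit ⊕ (l ⊕ l)) (Unit ⊕ (l ⊕ l)) K⦄, m ∈ P → Matrix.trace m = 0)
    {X : Matrix (Unit ⊕ (l ⊕ l)) (Unit ⊕ (l ⊕ l)) K} (hXP : X ∈ P) (hX0 : X ≠ 0) :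
    ∃ a : l, fromBlocks (0 : Matrix Unit Unit K) 0 0 (single (inr a) (inl a) (1 : K)) ∈ P := by
  classical
  -- the projection onto the `𝔬(2l)`-block and the projected subspace `P'`
  let π : Matrix (Unit ⊕ (l ⊕ l)) (Unit ⊕ (l ⊕ l)) K →ₗ[K] Matrix (l ⊕ l) (l ⊕ l) K :=
    { toFun := fun M => M.toBlocks₂₂, map_add' := fun _ _ => rfl, map_smul' := fun _ _ => rfl }
  let P' : Submodule K (Matrix (l ⊕ l) (l ⊕ l) K) := P.map π
  have hP'mem : ∀ {Z : Matrix (l ⊕ l) (l ⊕ l) K}, Z ∈ P' ↔ ∃ W ∈ P, W.toBlocks₂₂ = Z := fun {Z} => Submodule.mem_map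
  have hP'stab : ∀ ⦃A Z : Matrix (l ⊕ l) (l ⊕ l) K⦄, A ∈ typeD l K → Z ∈ P' → A * Z - Z * A ∈ P' := by
    intro A Z hA hZ
    obtain ⟨W, hW, rfl⟩ := hP'mem.1 hZ
    refine hP'mem.2 ⟨_, hP (OrthogonalSimpleTypeB.fromBlocks_zero_zero_zero_mem_typeB hA) hW, ?_⟩
    conv_lhs => rw [← fromBlocks_toBlocks W, emb_comm, toBlocks_fromBlocks₂₂]
  have hP'sa : ∀ ⦃Z : Matrix (l ⊕ l) (l ⊕ l) K⦄, Z ∈ P' → (JD l K).IsSelfAdjoint Z := by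
    intro Z hZ
    obtain ⟨W, hW, rfl⟩ := hP'mem.1 hZ
    exact toBlocks₂₂_isSelfAdjoint (hPS hW)
  -- (a) a member of `P` whose block has a usable entry gives some `E_{uu'} ∈ P'` (rows A1-174)
  have key : ∀ ⦃W : Matrix (Unit ⊕ (l ⊕ l)) (Unit ⊕ (l ⊕ l)) K⦄, W ∈ P → (∃ a b : l, a ≠ b ∧
      ((W (inr (inr b)) (inr (inl a)) ≠ 0 ∨ W (inr (inr b)) (inr (inl b)) ≠ 0 ∨ W (inr (inr a)) (inr (inl a)) ≠ 0)
        ∨ (W (inr (inl a)) (inr (inr b)) ≠ 0 ∨ W (inr (inl a)) (inr (inr a)) ≠ 0 ∨ W (inr (inl b)) (inr (inr b)) ≠ 0)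
        ∨ (W (inr (inl a)) (inr (inl b)) ≠ 0 ∨ W (inr (inl b)) (inr (inl a)) ≠ 0
            ∨ W (inr (inl a)) (inr (inl a)) ≠ W (inr (inl b)) (inr (inl b))))) →
      ∃ u : l, single (inl u) (inr u) (1 : K) ∈ P' := by
    rintro W hW ⟨a, b, hab, h⟩
    have hWP' : W.toBlocks₂₂ ∈ P' := hP'mem.2 ⟨W, hW, rfl⟩
    rcases h with h | h | h
    · exact OrthogonalSelfAdjointTypeD.exists_single_inl_inr_mem_of_lowerLeft h2 hP'stab (hP'sa hWP') hWP' hab h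
    · exact OrthogonalSelfAdjointTypeD.exists_single_inl_inr_mem_of_upperRight h2 hP'stab hP'sa hWP' hab h
    · exact OrthogonalSelfAdjointTypeD.exists_single_inl_inr_mem_of_upperLeft h2 hP'stab hP'sa hWP' hab h
  -- (b) a member of `P` with a non-zero first-row entry gives such a member after a bracket with `u_i`
  have key2 : ∀ ⦃W : Matrix (Unit ⊕ (l ⊕ l)) (Unit ⊕ (l ⊕ l)) K⦄, W ∈ P → (∃ q : l ⊕ l, W (inl ()) (inr q) ≠ 0) →
      ∃ u : l, single (inl u) (inr u) (1 : K) ∈ P' := by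
    rintro W hW ⟨q, hq⟩
    obtain ⟨j, hj⟩ : ∃ j : l, q = inl j ∨ q = inr j := by
      rcases q with j | j
      exacts [⟨j, Or.inl rfl⟩, ⟨j, Or.inr rfl⟩]
    obtain ⟨i, hij⟩ := Fintype.exists_ne_of_one_lt_card h1 j
    have hW' := hP (OrthogonalSimpleTypeB.usub_mem_typeB (R := K) i) hW
    have hqi : q ≠ inr i := by
      rcases hj with rfl | rfl
      · exact inl_ne_inr
      · exact fun h => hij (inr_injective h).symm
    have hne : (((single (inl ()) (inr (inr i)) (1 : K) - (2 : K) • single (inr (inl i)) (inl ()) 1) * W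
        - W * (single (inl ()) (inr (inr i)) (1 : K) - (2 : K) • single (inr (inl i)) (inl ()) 1)
        : Matrix (Unit ⊕ (l ⊕ l)) (Unit ⊕ (l ⊕ l)) K)) (inr (inl i)) (inr q) ≠ 0 := by
      rw [usub_comm_apply_inr_inl_inr W hqi, neg_ne_zero]
      exact mul_ne_zero h2 hq
    refine key hW' ⟨i, j, hij, ?_⟩
    rcases hj with rfl | rfl
    · exact Or.inr (Or.inr (Or.inl hne))
    · exact Or.inr (Or.inl (Or.inl hne))
  have hX := hPS hXP
  -- (c) the case analysis on `X`
  obtain ⟨u, hu⟩ : ∃ u : l, single (inl u) (inr u) (1 : K) ∈ P' := by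
    by_cases hr : ∃ q : l ⊕ l, X (inl ()) (inr q) ≠ 0
    · exact key2 hXP hr
    by_cases hD : ∃ a b : l, a ≠ b ∧
      ((X (inr (inr b)) (inr (inl a)) ≠ 0 ∨ X (inr (inr b)) (inr (inl b)) ≠ 0 ∨ X (inr (inr a)) (inr (inl a)) ≠ 0)
        ∨ (X (inr (inl a)) (inr (inr b)) ≠ 0 ∨ X (inr (inl a)) (inr (inr a)) ≠ 0 ∨ X (inr (inl b)) (inr (inr b)) ≠ 0)
        ∨ (X (inr (inl a)) (inr (inl b)) ≠ 0 ∨ X (inr (inl b)) (inr (inl a)) ≠ 0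
            ∨ X (inr (inl a)) (inr (inl a)) ≠ X (inr (inl b)) (inr (inl b))))
    · exact key hXP hD
    by_cases hd : ∃ i : l, X (inr (inr i)) (inr (inr i)) ≠ X (inl ()) (inl ())
    · obtain ⟨i, hi⟩ := hd
      have hW := hP (OrthogonalSimpleTypeB.usub_mem_typeB (R := K) i) hXP
      refine key2 hW ⟨inr i, ?_⟩
      rw [usub_comm_apply_inl_inr_inr, sub_ne_zero]
      exact hi
    push Not at hr hD hd
    -- now `X = c·1` with `(2|l|+1)c = tr X = 0`
    exfalso
    apply hX0
    have hne : Nonempty l := Fintype.card_pos_iff.1 (by omega)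
    have hdiag : ∀ i : l, X (inr (inl i)) (inr (inl i)) = X (inl ()) (inl ()) := fun i ↦ by
      rw [← apply_inr_inr_inr_inr hX i i]
      exact hd i
    have hc : X (inl ()) (inl ()) = 0 := by
      have htr := hPT hXP
      rw [trace_eq hX] at htr
      simp only [hdiag, Finset.sum_const, Finset.card_univ, nsmul_eq_mul] at htr
      have : ((2 * Fintype.card l + 1 : ℕ) : K) * X (inl ()) (inl ()) = 0 := by
        push_cast
        linear_combination htr
      exact (mul_eq_zero.1 this).resolve_left hl'
    ext p q
    rw [Matrix.zero_apply]
    rcases p with ⟨⟩ | p <;> rcases q with ⟨⟩ | q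
    · exact hc
    · exact hr q
    · rcases p with i | i
      · rw [apply_inr_inl_inl hX, hr, mul_zero]
      · rw [apply_inr_inr_inl hX, hr, mul_zero]
    · rcases p with i | i <;> rcases q with j | j
      · by_cases hij : i = j
        · subst hij; rw [hdiag, hc]
        · exact (hD i j hij).2.2.1
      · by_cases hij : i = j
        · subst hij
          obtain ⟨k, hki⟩ := Fintype.exists_ne_of_one_lt_card h1 i
          exact (hD i k (Ne.symm hki)).2.1.2.1
        · exact (hD i j hij).2.1.1
      · by_cases hij : i = j
        · subst hij
          obtain ⟨k, hki⟩ := Fintype.exists_ne_of_one_lt_card h1 i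
          exact (hD i k (Ne.symm hki)).1.2.2
        · exact (hD j i (Ne.symm hij)).1.1
      · rw [apply_inr_inr_inr_inr hX]
        by_cases hji : j = i
        · subst hji; rw [hdiag, hc]
        · exact (hD j i hji).2.2.1
  -- (d) squeeze a member with block `E_{uu'}` to the embedded `-E_{a'a}` (`a ≠ u`)
  obtain ⟨W, hW, hWb⟩ := hP'mem.1 hu
  obtain ⟨a, hau⟩ := Fintype.exists_ne_of_one_lt_card h1 u
  refine ⟨a, ?_⟩
  have hp := OrthogonalSimpleTypeB.psub_mem_typeB (R := K) a u
  have h3 := hP hp (hP hp hW)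
  rw [OrthogonalSimpleTypeD.comm_comm_eq_of_mul_self_eq_zero (OrthogonalSimpleTypeB.psub_mul_self a u), P.neg_mem_iff,
    P.smul_mem_iff h2] at h3
  have hpe : (single (inr (inr a)) (inr (inl u)) (1 : K) - single (inr (inr u)) (inr (inl a)) 1
        : Matrix (Unit ⊕ (l ⊕ l)) (Unit ⊕ (l ⊕ l)) K)
      = fromBlocks 0 0 0 (single (inr a) (inl u) (1 : K) - single (inr u) (inl a) 1) := by
    rw [OrthogonalSimpleTypeB.fromBlocks_zero_zero_zero_sub, OrthogonalSimpleTypeB.fromBlocks_zero_zero_zero_single,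
      OrthogonalSimpleTypeB.fromBlocks_zero_zero_zero_single]
  rw [hpe, ← fromBlocks_toBlocks W, emb_mul_mul_emb, hWb, OrthogonalSimpleTypeD.psub_mul_mul_psub] at h3
  have hua : (inr u : l ⊕ l) ≠ inr a := fun h => hau (inr_injective h).symm
  have hua' : (inl u : l ⊕ l) ≠ inl a := fun h => hau (inl_injective h).symm
  simp only [single_apply_same, single_apply_of_col_ne _ _ hua, single_apply_of_row_ne hua', single_zero, zero_sub,
    sub_zero, add_zero] at h3
  have e : fromBlocks (0 : Matrix Unit Unit K) 0 0 (-(single (inr a) (inl a) (1 : K) : Matrix (l ⊕ l) (l ⊕ l) K))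
      = -fromBlocks (0 : Matrix Unit Unit K) 0 0 (single (inr a) (inl a) (1 : K) : Matrix (l ⊕ l) (l ⊕ l) K) := by
    rw [fromBlocks_neg]
    simp
  rw [e, P.neg_mem_iff] at h3
  exact h3

/-! ### §4 Generation: from the embedded `Sym²₀(2l)` to all traceless `JB`-self-adjoint matrices -/

/-- **Step 2.** If `P` is stable under `ad 𝔬(2l+1)` (`2 ≠ 0`, `|l| ≥ 2`) and contains EVERY embedded traceless
`JD`-self-adjoint matrix `(0 0; 0 Z)`, then `P` contains every traceless `JB`-self-adjoint matrix: the brackets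
`[u_i, (0 0; 0 E_{i'j} + E_{j'i})] = E_{0,j} + 2E_{j',0}`, `[u_i, (0 0; 0 E_{ji} + E_{i'j'})] = E_{0,j'} + 2E_{j,0}` (`i ≠ j`)
give the first row/column, `[u_i, E_{0,i} + 2E_{i',0}] = 2(2E_{00} - E_{ii} - E_{i'i'})` the missing diagonal direction, and
`(x r; c Y) = Σ_q r_q (E_{0,q} + 2E_{q̄,0}) + ½x(2E_{00} - E_{ii} - E_{i'i'}) + (0 0; 0 Y + ½x(E_{ii} + E_{i'i'}))`.
[cite: Humphreys1972, §1.2, p. 3 (type B_ℓ), §20.2] [cite: LooijengaLunts1997, Appendix (7.5), p. 28 L89] -/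
theorem mem_of_forall_emb_mem (h2 : (2 : K) ≠ 0) (h1 : 1 < Fintype.card l)
    (hP : ∀ ⦃Y m : Matrix (Unit ⊕ (l ⊕ l)) (Unit ⊕ (l ⊕ l)) K⦄, Y ∈ typeB l K → m ∈ P → Y * m - m * Y ∈ P)
    (hemb : ∀ ⦃Z : Matrix (l ⊕ l) (l ⊕ l) K⦄, (JD l K).IsSelfAdjoint Z → Matrix.trace Z = 0 →
      fromBlocks (0 : Matrix Unit Unit K) 0 0 Z ∈ P)
    {X : Matrix (Unit ⊕ (l ⊕ l)) (Unit ⊕ (l ⊕ l)) K} (hX : (JB l K).IsSelfAdjoint X) (htr : Matrix.trace X = 0) :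
    X ∈ P := by
  classical
  have hPsmul : ∀ {c : K} {m : Matrix (Unit ⊕ (l ⊕ l)) (Unit ⊕ (l ⊕ l)) K}, c ≠ 0 → c • m ∈ P → m ∈ P :=
    fun hc hm => (P.smul_mem_iff hc).1 hm
  -- the embedding as a linear map
  let L : Matrix (l ⊕ l) (l ⊕ l) K →ₗ[K] Matrix (Unit ⊕ (l ⊕ l)) (Unit ⊕ (l ⊕ l)) K :=
    { toFun := fun Z => fromBlocks 0 0 0 Z
      map_add' := fun Z Z' => by rw [fromBlocks_add]; simp
      map_smul' := fun c Z => by rw [RingHom.id_apply, fromBlocks_smul]; simp }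
  have hL : ∀ Z, L Z = fromBlocks 0 0 0 Z := fun _ => rfl
  have hLE : ∀ p q : l ⊕ l, L (single p q (1 : K)) = single (inr p) (inr q) 1 :=
    fun p q => OrthogonalSimpleTypeB.fromBlocks_zero_zero_zero_single p q 1
  -- the first-row units `E_{0,j} + 2E_{j',0}` and `E_{0,j'} + 2E_{j,0}`
  have hwl : ∀ j : l, (single (inl ()) (inr (inl j)) (1 : K) + (2 : K) • single (inr (inr j)) (inl ()) 1
      : Matrix (Unit ⊕ (l ⊕ l)) (Unit ⊕ (l ⊕ l)) K) ∈ P := by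
    intro j
    obtain ⟨i, hij⟩ := Fintype.exists_ne_of_one_lt_card h1 j
    have hji : (inr i : l ⊕ l) ≠ inl j := inr_ne_inl
    have hZ : L (single (inr i) (inl j) (1 : K) + single (inr j) (inl i) 1) ∈ P :=
      hemb (OrthogonalSelfAdjointTypeD.single_inr_inl_add_isSelfAdjoint i j)
        (by rw [trace_add, trace_single_eq_of_ne _ _ _ inr_ne_inl, trace_single_eq_of_ne _ _ _ inr_ne_inl, add_zero])
    rw [map_add, hLE, hLE] at hZ
    have h := hP (OrthogonalSimpleTypeB.usub_mem_typeB (R := K) i) hZ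
    rwa [usub_comm_emb_cadd hij] at h
  have hwr : ∀ j : l, (single (inl ()) (inr (inr j)) (1 : K) + (2 : K) • single (inr (inl j)) (inl ()) 1
      : Matrix (Unit ⊕ (l ⊕ l)) (Unit ⊕ (l ⊕ l)) K) ∈ P := by
    intro j
    obtain ⟨i, hij⟩ := Fintype.exists_ne_of_one_lt_card h1 j
    have hji1 : (inl j : l ⊕ l) ≠ inl i := fun h => hij (inl_injective h).symm
    have hji2 : (inr i : l ⊕ l) ≠ inr j := fun h => hij (inr_injective h)
    have hZ : L (single (inl j) (inl i) (1 : K) + single (inr i) (inr j) 1) ∈ P :=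
      hemb (OrthogonalSelfAdjointTypeD.single_inl_inl_add_single_inr_inr_isSelfAdjoint j i)
        (by rw [trace_add, trace_single_eq_of_ne _ _ _ hji1, trace_single_eq_of_ne _ _ _ hji2, add_zero])
    rw [map_add, hLE, hLE] at hZ
    have h := hP (OrthogonalSimpleTypeB.usub_mem_typeB (R := K) i) hZ
    rwa [usub_comm_emb_qadd i j] at h
  -- the diagonal direction `T_i = 2E_{00} - E_{ii} - E_{i'i'}`
  have hT : ∀ i : l, ((2 : K) • single (inl ()) (inl ()) (1 : K) - single (inr (inl i)) (inr (inl i)) 1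
      - single (inr (inr i)) (inr (inr i)) 1 : Matrix (Unit ⊕ (l ⊕ l)) (Unit ⊕ (l ⊕ l)) K) ∈ P := by
    intro i
    have h := hP (OrthogonalSimpleTypeB.usub_mem_typeB (R := K) i) (hwl i)
    rw [usub_comm_wadd] at h
    exact hPsmul h2 h
  -- decomposition of `X = (x r; c Y)`
  obtain ⟨i₀⟩ : Nonempty l := Fintype.card_pos_iff.1 (by omega)
  rw [← fromBlocks_toBlocks X] at hX htr ⊢
  obtain ⟨hc, hY⟩ := (fromBlocks_isSelfAdjoint_JB_iff' _ _ _ _).1 hX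
  rw [trace_fromBlocks'] at htr
  have e : fromBlocks X.toBlocks₁₁ X.toBlocks₁₂ X.toBlocks₂₁ X.toBlocks₂₂
      = fromBlocks 0 X.toBlocks₁₂ X.toBlocks₂₁ 0 + (fromBlocks X.toBlocks₁₁ 0 0 0 + fromBlocks 0 0 0 X.toBlocks₂₂) := by
    rw [fromBlocks_add, fromBlocks_add]
    simp
  rw [e]
  refine add_mem ?_ ?_
  · -- the first row and column: `Σ_q r_q (E_{0,q} + 2E_{q̄,0})`
    let Lr : Matrix Unit (l ⊕ l) K →ₗ[K] Matrix (Unit ⊕ (l ⊕ l)) (Unit ⊕ (l ⊕ l)) K :=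
      { toFun := fun r => fromBlocks 0 r ((2 : K) • (JD l K * rᵀ)) 0
        map_add' := fun r r' => by
          rw [transpose_add, Matrix.mul_add, smul_add, fromBlocks_add]
          simp
        map_smul' := fun c r => by
          rw [RingHom.id_apply, transpose_smul, Matrix.mul_smul, smul_comm, fromBlocks_smul]
          simp }
    have hLr : ∀ q : l ⊕ l, Lr (single () q (1 : K)) ∈ P := by
      intro q
      change fromBlocks 0 (single () q (1 : K)) ((2 : K) • (JD l K * (single () q (1 : K))ᵀ)) 0 ∈ P
      rw [transpose_single]
      rcases q with j | j
      · have e' : fromBlocks (0 : Matrix Unit Unit K) (single () (inl j) (1 : K)) ((2 : K) • single (inr j) () (1 : K))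
            (0 : Matrix (l ⊕ l) (l ⊕ l) K)
            = single (inl ()) (inr (inl j)) 1 + (2 : K) • single (inr (inr j)) (inl ()) 1 := by
          rw [← OrthogonalSimpleTypeB.fromBlocks_zero_single_zero_zero, ← OrthogonalSimpleTypeB.fromBlocks_zero_zero_single_zero,
            fromBlocks_smul, fromBlocks_add]
          simp
        rw [OrthogonalSimpleTypeB.JD_mul_single_inl, e']
        exact hwl j
      · have e' : fromBlocks (0 : Matrix Unit Unit K) (single () (inr j) (1 : K)) ((2 : K) • single (inl j) () (1 : K))
            (0 : Matrix (l ⊕ l) (l ⊕ l) K)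
            = single (inl ()) (inr (inr j)) 1 + (2 : K) • single (inr (inl j)) (inl ()) 1 := by
          rw [← OrthogonalSimpleTypeB.fromBlocks_zero_single_zero_zero, ← OrthogonalSimpleTypeB.fromBlocks_zero_zero_single_zero,
            fromBlocks_smul, fromBlocks_add]
          simp
        rw [OrthogonalSimpleTypeB.JD_mul_single_inr, e']
        exact hwr j
    have er : fromBlocks 0 X.toBlocks₁₂ X.toBlocks₂₁ (0 : Matrix (l ⊕ l) (l ⊕ l) K) = Lr X.toBlocks₁₂ := by
      rw [hc]
      rfl
    have hr : X.toBlocks₁₂ = ∑ q, X.toBlocks₁₂ () q • single () q (1 : K) := by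
      have h := matrix_eq_sum_single X.toBlocks₁₂
      rw [Fintype.sum_unique] at h
      simpa only [smul_single, smul_eq_mul, mul_one, PUnit.default_eq_unit] using h
    rw [er, hr, map_sum]
    exact P.sum_mem fun q _ => by rw [map_smul]; exact P.smul_mem _ (hLr q)
  · -- `2·((x 0; 0 0) + (0 0; 0 Y)) = x T_{i₀} + (0 0; 0 2Y + x d_{i₀})`
    refine hPsmul h2 ?_
    set x₀ : K := X.toBlocks₁₁ () () with hx₀
    have hxe : fromBlocks X.toBlocks₁₁ 0 0 (0 : Matrix (l ⊕ l) (l ⊕ l) K)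
        = x₀ • (single (inl ()) (inl ()) (1 : K) : Matrix (Unit ⊕ (l ⊕ l)) (Unit ⊕ (l ⊕ l)) K) := by
      ext p q
      rcases p with ⟨⟩ | p <;> rcases q with ⟨⟩ | q <;> simp [hx₀]
    have hde : L (single (inl i₀) (inl i₀) (1 : K) + single (inr i₀) (inr i₀) 1)
        = single (inr (inl i₀)) (inr (inl i₀)) 1 + single (inr (inr i₀)) (inr (inr i₀)) 1 := by
      rw [map_add, hLE, hLE]
    have e2 : (2 : K) • (fromBlocks X.toBlocks₁₁ 0 0 (0 : Matrix (l ⊕ l) (l ⊕ l) K) + fromBlocks 0 0 0 X.toBlocks₂₂)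
        = x₀ • ((2 : K) • single (inl ()) (inl ()) (1 : K) - single (inr (inl i₀)) (inr (inl i₀)) 1
            - single (inr (inr i₀)) (inr (inr i₀)) 1)
          + L ((2 : K) • X.toBlocks₂₂ + x₀ • (single (inl i₀) (inl i₀) (1 : K) + single (inr i₀) (inr i₀) 1)) := by
      rw [hxe, map_add, map_smul, map_smul, hde, ← hL X.toBlocks₂₂]
      module
    rw [e2]
    refine add_mem (P.smul_mem _ (hT i₀)) (hemb ?_ ?_)
    · rw [← mem_selfAdjointMatricesSubmodule] at hY ⊢
      exact add_mem (Submodule.smul_mem _ _ hY) (Submodule.smul_mem _ _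
        ((mem_selfAdjointMatricesSubmodule _ _).2
          (OrthogonalSelfAdjointTypeD.single_inl_inl_add_single_inr_inr_isSelfAdjoint i₀ i₀)))
    · rw [trace_add, trace_smul, trace_smul, trace_add, trace_single_eq_same, trace_single_eq_same, smul_eq_mul,
        smul_eq_mul]
      linear_combination (2 : K) * htr

/-- **The elementary core** (type `B_ℓ`): for `2 ≠ 0`, `|l| ≠ 0` and `2|l| + 1 ≠ 0` in `K`, `|l| ≥ 2`, a `K`-subspace `P`
of TRACELESS `JB`-SELF-ADJOINT matrices (`JB = (2) ⊕ (0 I; I 0)`, size `2|l| + 1`) stable under `m ↦ Ym - mY` for all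
`Y ∈ 𝔬(2l+1, K) = typeB l K` is `0` or contains every traceless `JB`-self-adjoint matrix — the summand `𝔤_+(U)` of
Looijenga–Lunts (7.5) is irreducible under `𝔞𝔲𝔱(U) = 𝔬(2l+1)` (split odd orthogonal form; `Sym²₀` of the defining
representation of `B_ℓ`).  Step 1 (`exists_emb_single_mem_of_ne_zero`) puts an embedded `E_{a'a}` into `P`, rows
A1-174's core then gives the whole embedded `Sym²₀(2l)` (this uses `|l| ≠ 0` in `K`), and Step 2 generates.
[cite: LooijengaLunts1997, Appendix (7.5), p. 28 L89 ("The summands are irreducible")] [cite: Humphreys1972, §19.2, §20.1–§20.2] -/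
theorem eq_bot_or_forall_mem_of_forall_comm_mem (h2 : (2 : K) ≠ 0) (hl : ((Fintype.card l : ℕ) : K) ≠ 0)
    (hl' : ((2 * Fintype.card l + 1 : ℕ) : K) ≠ 0) (h1 : 1 < Fintype.card l)
    (hP : ∀ ⦃Y m : Matrix (Unit ⊕ (l ⊕ l)) (Unit ⊕ (l ⊕ l)) K⦄, Y ∈ typeB l K → m ∈ P → Y * m - m * Y ∈ P)
    (hPS : ∀ ⦃m : Matrix (Unit ⊕ (l ⊕ l)) (Unit ⊕ (l ⊕ l)) K⦄, m ∈ P → (JB l K).IsSelfAdjoint m)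
    (hPT : ∀ ⦃m : Matrix (Unit ⊕ (l ⊕ l)) (Unit ⊕ (l ⊕ l)) K⦄, m ∈ P → Matrix.trace m = 0) :
    P = ⊥ ∨ ∀ ⦃X : Matrix (Unit ⊕ (l ⊕ l)) (Unit ⊕ (l ⊕ l)) K⦄,
      (JB l K).IsSelfAdjoint X → Matrix.trace X = 0 → X ∈ P := by
  classical
  by_cases hbot : P = ⊥
  · exact Or.inl hbot
  right
  obtain ⟨X, hXP, hX0⟩ := (Submodule.ne_bot_iff P).1 hbot
  obtain ⟨a, ha⟩ := exists_emb_single_mem_of_ne_zero h2 hl' h1 hP hPS hPT hXP hX0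
  -- the embedded subspace `P_D = {Z | (0 0; 0 Z) ∈ P}`
  let L : Matrix (l ⊕ l) (l ⊕ l) K →ₗ[K] Matrix (Unit ⊕ (l ⊕ l)) (Unit ⊕ (l ⊕ l)) K :=
    { toFun := fun Z => fromBlocks 0 0 0 Z
      map_add' := fun Z Z' => by rw [fromBlocks_add]; simp
      map_smul' := fun c Z => by rw [RingHom.id_apply, fromBlocks_smul]; simp }
  let PD : Submodule K (Matrix (l ⊕ l) (l ⊕ l) K) := P.comap L
  have hPDmem : ∀ {Z : Matrix (l ⊕ l) (l ⊕ l) K}, Z ∈ PD ↔ fromBlocks (0 : Matrix Unit Unit K) 0 0 Z ∈ P :=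
    fun {Z} => Iff.rfl
  have hPDstab : ∀ ⦃A Z : Matrix (l ⊕ l) (l ⊕ l) K⦄, A ∈ typeD l K → Z ∈ PD → A * Z - Z * A ∈ PD := by
    intro A Z hA hZ
    rw [hPDmem, OrthogonalSimpleTypeB.fromBlocks_zero_zero_zero_sub, ← emb_mul_emb, ← emb_mul_emb]
    exact hP (OrthogonalSimpleTypeB.fromBlocks_zero_zero_zero_mem_typeB hA) (hPDmem.1 hZ)
  have hPDsa : ∀ ⦃Z : Matrix (l ⊕ l) (l ⊕ l) K⦄, Z ∈ PD → (JD l K).IsSelfAdjoint Z := by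
    intro Z hZ
    have h := toBlocks₂₂_isSelfAdjoint (hPS (hPDmem.1 hZ))
    rwa [toBlocks_fromBlocks₂₂] at h
  have hPDtr : ∀ ⦃Z : Matrix (l ⊕ l) (l ⊕ l) K⦄, Z ∈ PD → Matrix.trace Z = 0 := by
    intro Z hZ
    have h := hPT (hPDmem.1 hZ)
    rw [trace_fromBlocks', Matrix.zero_apply, zero_add] at h
    exact h
  have hPDne : PD ≠ ⊥ := by
    intro h
    have hZ : single (inr a) (inl a) (1 : K) ∈ PD := hPDmem.2 ha
    rw [h, Submodule.mem_bot] at hZ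
    have h1a := congrFun (congrFun hZ (inr a)) (inl a)
    rw [single_apply_same, Matrix.zero_apply] at h1a
    exact one_ne_zero h1a
  rcases OrthogonalSelfAdjointTypeD.eq_bot_or_forall_mem_of_forall_comm_mem h2 hl h1 hPDstab hPDsa hPDtr with h | h
  · exact absurd h hPDne
  intro Y hY hYtr
  exact mem_of_forall_emb_mem h2 h1 hP (fun Z hZ hZtr => hPDmem.1 (h hZ hZtr)) hY hYtr

end stable

/-! ### §5 `Sym²₀(2l+1)` is an irreducible `𝔬(2l+1)`-module: the subspace statement -/

/-- Membership in `𝔤_+ = sym_s ∩ 𝔰𝔩` for `s = JB`. [cite: LooijengaLunts1997, Appendix (7.5), p. 28 L80–L84] -/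
theorem mem_selfAdjoint_inf_ker_trace_iff (X : Matrix (Unit ⊕ (l ⊕ l)) (Unit ⊕ (l ⊕ l)) K) :
    X ∈ selfAdjointMatricesSubmodule (JB l K) ⊓ LinearMap.ker (Matrix.traceLinearMap (Unit ⊕ (l ⊕ l)) K K)
      ↔ (JB l K).IsSelfAdjoint X ∧ Matrix.trace X = 0 := by
  rw [Submodule.mem_inf, mem_selfAdjointMatricesSubmodule, LinearMap.mem_ker, Matrix.traceLinearMap_apply]

/-- **Looijenga–Lunts (7.5), "the summands are irreducible" — the summand `𝔤_+(U)` for a split ODD orthogonal form, in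
matrices**: for `s = JB = (2) ⊕ (0 I; I 0)` of size `2|l| + 1` (`2 ≠ 0`, `|l| ≠ 0`, `2|l|+1 ≠ 0` in `K`, `|l| ≥ 2`, i.e.
`dim U ≥ 5`), every `K`-subspace `P ⊆ 𝔤_+ = {X : Xᵀs = sX, tr X = 0}` stable under `X ↦ AX - XA` for all
`A ∈ 𝔬(2l+1, K) = typeB l K` is `⊥` or `𝔤_+`. [cite: LooijengaLunts1997, Appendix (7.5), p. 28 L86–L90] [cite: Humphreys1972, §19.2, §20.1–§20.2] -/
theorem eq_bot_or_eq_of_forall_comm_mem (h2 : (2 : K) ≠ 0) (hl : ((Fintype.card l : ℕ) : K) ≠ 0)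
    (hl' : ((2 * Fintype.card l + 1 : ℕ) : K) ≠ 0) (h1 : 1 < Fintype.card l)
    {P : Submodule K (Matrix (Unit ⊕ (l ⊕ l)) (Unit ⊕ (l ⊕ l)) K)}
    (hle : P ≤ selfAdjointMatricesSubmodule (JB l K) ⊓ LinearMap.ker (Matrix.traceLinearMap (Unit ⊕ (l ⊕ l)) K K))
    (hP : ∀ A ∈ typeB l K, ∀ X ∈ P, A * X - X * A ∈ P) :
    P = ⊥ ∨ P = selfAdjointMatricesSubmodule (JB l K) ⊓ LinearMap.ker (Matrix.traceLinearMap (Unit ⊕ (l ⊕ l)) K K) := by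
  have hPS : ∀ ⦃m : Matrix (Unit ⊕ (l ⊕ l)) (Unit ⊕ (l ⊕ l)) K⦄, m ∈ P → (JB l K).IsSelfAdjoint m :=
    fun m hm => ((mem_selfAdjoint_inf_ker_trace_iff m).1 (hle hm)).1
  have hPT : ∀ ⦃m : Matrix (Unit ⊕ (l ⊕ l)) (Unit ⊕ (l ⊕ l)) K⦄, m ∈ P → Matrix.trace m = 0 :=
    fun m hm => ((mem_selfAdjoint_inf_ker_trace_iff m).1 (hle hm)).2
  rcases eq_bot_or_forall_mem_of_forall_comm_mem h2 hl hl' h1 (fun Y m hY hm => hP Y hY m hm) hPS hPT with h | h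
  · exact Or.inl h
  · right
    refine le_antisymm hle fun X hX => ?_
    obtain ⟨hXs, hXt⟩ := (mem_selfAdjoint_inf_ker_trace_iff X).1 hX
    exact h hXs hXt

/-- The same in characteristic `0`, `|l| ≥ 2`. [cite: LooijengaLunts1997, Appendix (7.5), p. 28 L86–L90] -/
theorem eq_bot_or_eq_of_forall_comm_mem_of_charZero [CharZero K] (h1 : 1 < Fintype.card l)
    {P : Submodule K (Matrix (Unit ⊕ (l ⊕ l)) (Unit ⊕ (l ⊕ l)) K)}
    (hle : P ≤ selfAdjointMatricesSubmodule (JB l K) ⊓ LinearMap.ker (Matrix.traceLinearMap (Unit ⊕ (l ⊕ l)) K K))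
    (hP : ∀ A ∈ typeB l K, ∀ X ∈ P, A * X - X * A ∈ P) :
    P = ⊥ ∨ P = selfAdjointMatricesSubmodule (JB l K) ⊓ LinearMap.ker (Matrix.traceLinearMap (Unit ⊕ (l ⊕ l)) K K) :=
  eq_bot_or_eq_of_forall_comm_mem two_ne_zero (Nat.cast_ne_zero.2 (by omega)) (Nat.cast_ne_zero.2 (by omega)) h1 hle hP

/-! ### §6 Basis-free transport: `𝔤_+(U)` for `U` orthogonal of ODD dimension `≥ 5` -/

section Transport

variable {V : Type*} [AddCommGroup V] [Module K V] {B : LinearMap.BilinForm K V}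

open Module in
/-- **Split odd form, any field with `2 ≠ 0`, `|m| ≠ 0`, `2|m|+1 ≠ 0`** (`|m| ≥ 2`): if `B` has a basis with Gram matrix
`JB m K`, then every `ad(𝔰𝔬(U, B))`-stable `K`-subspace of `𝔤_+(U) = sym_B(U) ∩ 𝔰𝔩(U)` is `⊥` or `𝔤_+(U)` (rows A1-175's
transport `OrthogonalSelfAdjointTypeD.eq_bot_or_eq_of_core`). [cite: LooijengaLunts1997, Appendix (7.5), p. 28 L86–L90] [cite: Humphreys1972, §1.2 p. 3, §20.1–§20.2] -/
theorem eq_bot_or_eq_of_forall_lie_mem_of_toMatrix_eq_JB [NeZero (2 : K)] {m : Type*} [Fintype m] [DecidableEq m]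
    (b : Basis (Unit ⊕ (m ⊕ m)) K V) (hb : LinearMap.BilinForm.toMatrix b B = JB m K)
    (hm : ((Fintype.card m : ℕ) : K) ≠ 0) (hm' : ((2 * Fintype.card m + 1 : ℕ) : K) ≠ 0) (h1 : 1 < Fintype.card m)
    {P : Submodule K (Module.End K V)} (hP : P ≤ B.selfAdjointSubmodule ⊓ LinearMap.ker (LinearMap.trace K V))
    (hstab : ∀ a ∈ B.skewAdjointSubmodule, ∀ x ∈ P, ⁅a, x⁆ ∈ P) :
    P = ⊥ ∨ P = B.selfAdjointSubmodule ⊓ LinearMap.ker (LinearMap.trace K V) := by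
  refine OrthogonalSelfAdjointTypeD.eq_bot_or_eq_of_core b (fun P' hst hsa htr ↦ ?_) hP hstab
  rw [hb] at hst hsa ⊢
  exact eq_bot_or_forall_mem_of_forall_comm_mem (P := P') (NeZero.ne 2) hm hm' h1
    (fun Y n hY hn ↦ hst ((OrthogonalAlgebraSimple.isSkewAdjoint_JB_iff_mem_typeB Y).2 hY) hn) hsa htr

open Module in
/-- **ODD dimension `2m + 1 ≥ 5` over an algebraically closed field** (`2`, `m`, `2m+1` non-zero in `K`; e.g. `K = ℂ`): for a
non-degenerate symmetric `B`, the traceless `B`-self-adjoint operators `𝔤_+(U)` have no proper non-zero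
`ad(𝔰𝔬(U, B))`-stable subspace — through row A1-171's `exists_basis_toMatrix_eq_JB`.
[cite: LooijengaLunts1997, Appendix (7.5), p. 28 L86–L90 ("The summands are irreducible")] [cite: Humphreys1972, §20.1–§20.2] -/
theorem eq_bot_or_eq_of_forall_lie_mem_of_odd [IsAlgClosed K] [NeZero (2 : K)] [FiniteDimensional K V]
    (hB : B.Nondegenerate) (hs : ∀ u v : V, B u v = B v u) {m : ℕ} (hdim : finrank K V = m + m + 1)
    (hmK : (m : K) ≠ 0) (hmK' : ((2 * m + 1 : ℕ) : K) ≠ 0) (h2 : 2 ≤ m)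
    {P : Submodule K (Module.End K V)} (hP : P ≤ B.selfAdjointSubmodule ⊓ LinearMap.ker (LinearMap.trace K V))
    (hstab : ∀ a ∈ B.skewAdjointSubmodule, ∀ x ∈ P, ⁅a, x⁆ ∈ P) :
    P = ⊥ ∨ P = B.selfAdjointSubmodule ⊓ LinearMap.ker (LinearMap.trace K V) := by
  obtain ⟨b, hb⟩ := OrthogonalAlgebraSimple.exists_basis_toMatrix_eq_JB hB hs hdim
  refine eq_bot_or_eq_of_forall_lie_mem_of_toMatrix_eq_JB b hb ?_ ?_ ?_ hP hstab
  · rwa [Fintype.card_fin]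
  · rwa [Fintype.card_fin]
  · rwa [Fintype.card_fin]

open Module in
/-- The same in characteristic `0` (the paper's `K = ℂ`): odd `dim U = 2m + 1 ≥ 5`, `B` non-degenerate symmetric.
[cite: LooijengaLunts1997, Appendix (7.5), p. 28 L86–L90] -/
theorem eq_bot_or_eq_of_forall_lie_mem_of_odd_of_charZero [IsAlgClosed K] [CharZero K] [FiniteDimensional K V]
    (hB : B.Nondegenerate) (hs : ∀ u v : V, B u v = B v u) {m : ℕ} (hdim : finrank K V = m + m + 1) (h2 : 2 ≤ m)
    {P : Submodule K (Module.End K V)} (hP : P ≤ B.selfAdjointSubmodule ⊓ LinearMap.ker (LinearMap.trace K V))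
    (hstab : ∀ a ∈ B.skewAdjointSubmodule, ∀ x ∈ P, ⁅a, x⁆ ∈ P) :
    P = ⊥ ∨ P = B.selfAdjointSubmodule ⊓ LinearMap.ker (LinearMap.trace K V) :=
  eq_bot_or_eq_of_forall_lie_mem_of_odd hB hs hdim (Nat.cast_ne_zero.2 (by omega)) (Nat.cast_ne_zero.2 (by omega)) h2
    hP hstab

end Transport

end Literature.Algebra.Lie.OrthogonalSelfAdjointTypeB
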